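import Summits.AtomisticToContinuum.HydrodynamicLimit.Theorems.JParityClosureLocalSecondLawLedgerDefs
import Literature.MathematicalPhysics.KineticTheory.HardSphereEulerProofs
import Summits.AtomisticToContinuum.HydrodynamicLimit.Theorems.JParityClosureDensityCapGridUpgrade
import Summits.AtomisticToContinuum.HydrodynamicLimit.Theorems.LocalSecondLaw.Negative.LinearMajorant
import Summits.AtomisticToContinuum.HydrodynamicLimit.Theorems.LocalSecondLaw.Negative.EquilibriumL1
import Literature.Analysis.FluidPDE.HardSpherePhaseSpaceProofs

/-!
# Coarse-field Lipschitz bounds for the entropy-ledger line of `JParityClosure.LocalSecondLaw`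
(stmt-AtomisticToContinuum-13081, line `exact-entropy-ledger-three-passivities`; support of stubs P2, P3 and L)

Complements `Theorems/JParityClosureLocalSecondLawKineticStressAlgebra.lean` (particle-sum forms, stress bounds; not
imported) with the VECTOR-valued control of the cone fields of `Theorems/JParityClosureLocalSecondLawLedgerDefs.lean` at one
configuration `w`: joint continuity of `(w, x₀) ↦ m_r` (`continuous_momC_uncurry`), the sup bound
`‖m_r‖ ≤ (3/πr³)(½ + ke)` (`norm_momC_le`, from `(N+1)⁻¹∑‖vᵢ‖ ≤ ½ + ke`), Lipschitz bounds in the field point for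
the minimal-image distance — `ρ_r` and `m_r` are `3/(πr⁴)`-Lipschitz (times `½ + ke` for `m_r`), hence `u_r = m_r/ρ_r`
is Lipschitz with the strain constant `K(r, c, ke)` under a density floor `ρ_r ≥ c` (`norm_uC_sub_le`) — and two facts
about the crux's partial derivative `pD k = ∂ₖ` (junk `0` where not differentiable): `|∂ₖf| ≤ L` EVERYWHERE for a
field `L`-Lipschitz in the minimal-image distance (`abs_pD_le_of_lipschitz`: where the line derivative exists it is a
limit of difference quotients bounded by `L`, the coordinate line being `1`-Lipschitz into the torus), and joint
measurability of `(a, x) ↦ ∂ₖ(f a)(x)` for any jointly continuous family (`measurable_pD_uncurry`, Mathlib's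
`measurable_deriv_with_param`).  Used by the integrability package of P2 and by the a.e. calculus of L.

References: H. Spohn, *Large Scale Dynamics of Interacting Particles* (1991), Part I §3 (coarse fields).
-/

noncomputable section

namespace Summit.AtomisticToContinuum.HydrodynamicLimit.Theorems.LocalSecondLawLedger

open scoped BigOperators Topology Classical MeasureTheory ENNReal InnerProductSpace
open Filter Set MeasureTheory
open Literature.MathematicalPhysics.KineticTheory
open Literature.Analysis.FluidPDE
open Summit.AtomisticToContinuum.HydrodynamicLimit.Theorems.LocalSecondLawNegative

variable {N : ℕ}

/-! ## Finite-sum forms, continuity, measurability -/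

/-- The coarse momentum is jointly continuous in (configuration, field point). [folklore] -/
theorem continuous_momC_uncurry (r : ℝ) : Continuous fun p : Phase N × T3 => momC r p.1 p.2 := by
  have h : (fun p : Phase N × T3 => momC r p.1 p.2) =
      fun p => ((N + 1 : ℕ) : ℝ)⁻¹ • ∑ i, cone r (p.1 i).1 p.2 • (p.1 i).2 := by
    funext p; exact empiricalMomentumField_eq_sum p.1 (fun y => cone r y p.2)
  rw [h]
  have hterm : ∀ i : Fin (N + 1), Continuous fun p : Phase N × T3 => cone r (p.1 i).1 p.2 • (p.1 i).2 := by
    intro i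
    have hf : Continuous fun p : Phase N × T3 => (p.1 i).1 := ((continuous_apply i).comp continuous_fst).fst
    have hv : Continuous fun p : Phase N × T3 => (p.1 i).2 := ((continuous_apply i).comp continuous_fst).snd
    exact (continuous_cone_comp r hf continuous_snd).smul hv
  have hsum : Continuous fun p : Phase N × T3 => ∑ i, cone r (p.1 i).1 p.2 • (p.1 i).2 :=
    continuous_finsetSum _ fun i _ => hterm i
  exact hsum.const_smul (((N + 1 : ℕ) : ℝ)⁻¹)

/-- The coarse momentum is continuous in the field point. [folklore] -/
theorem continuous_momC (r : ℝ) (w : Phase N) : Continuous fun x₀ => momC r w x₀ := by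
  simpa only [Function.comp_def] using (continuous_momC_uncurry (N := N) r).comp (Continuous.prodMk_right w)

/-! ## Sup bounds -/

/-- Mean speed is controlled by the mean kinetic energy: `(N+1)⁻¹∑‖vᵢ‖ ≤ ½ + ke`. [folklore] -/
theorem meanSpeed_le (w : Phase N) : ((N + 1 : ℕ) : ℝ)⁻¹ * ∑ i, ‖(w i).2‖ ≤ 1 / 2 + ke w := by
  unfold ke
  have h : ∀ i : Fin (N + 1), ‖(w i).2‖ ≤ 1 / 2 + ‖(w i).2‖ ^ 2 / 2 := fun i => by
    nlinarith [sq_nonneg (‖(w i).2‖ - 1)]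
  have hN : (0 : ℝ) < ((N + 1 : ℕ) : ℝ) := by positivity
  calc ((N + 1 : ℕ) : ℝ)⁻¹ * ∑ i, ‖(w i).2‖
      ≤ ((N + 1 : ℕ) : ℝ)⁻¹ * ∑ i : Fin (N + 1), (1 / 2 + ‖(w i).2‖ ^ 2 / 2) := by
        gcongr with i; exact h i
    _ = 1 / 2 + ((N + 1 : ℕ) : ℝ)⁻¹ * ∑ i, ‖(w i).2‖ ^ 2 / 2 := by
        rw [Finset.sum_add_distrib, Finset.sum_const, Finset.card_univ, Fintype.card_fin, nsmul_eq_mul,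
          mul_add, ← mul_assoc, inv_mul_cancel₀ hN.ne', one_mul]

/-- `‖m_r‖ ≤ (3/πr³)(½ + ke)`. [folklore] -/
theorem norm_momC_le {r : ℝ} (hr : 0 < r) (w : Phase N) (x₀ : T3) :
    ‖momC r w x₀‖ ≤ 3 / (Real.pi * r ^ 3) * (1 / 2 + ke w) := by
  rw [show momC r w x₀ = ((N + 1 : ℕ) : ℝ)⁻¹ • ∑ i, cone r (w i).1 x₀ • (w i).2 from
    empiricalMomentumField_eq_sum w (fun y => cone r y x₀), norm_smul, Real.norm_eq_abs, abs_of_nonneg (by positivity)]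
  have hC : 0 ≤ 3 / (Real.pi * r ^ 3) := by positivity
  calc ((N + 1 : ℕ) : ℝ)⁻¹ * ‖∑ i, cone r (w i).1 x₀ • (w i).2‖
      ≤ ((N + 1 : ℕ) : ℝ)⁻¹ * ∑ i, 3 / (Real.pi * r ^ 3) * ‖(w i).2‖ := by
        gcongr
        refine (norm_sum_le _ _).trans (Finset.sum_le_sum fun i _ => ?_)
        rw [norm_smul, Real.norm_eq_abs, abs_of_nonneg (cone_nonneg hr _ _)]
        exact mul_le_mul_of_nonneg_right (cone_le_const hr _ _) (norm_nonneg _)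
    _ = 3 / (Real.pi * r ^ 3) * (((N + 1 : ℕ) : ℝ)⁻¹ * ∑ i, ‖(w i).2‖) := by
        rw [← Finset.mul_sum]; ring
    _ ≤ 3 / (Real.pi * r ^ 3) * (1 / 2 + ke w) := mul_le_mul_of_nonneg_left (meanSpeed_le w) hC

/-! ## Lipschitz bounds in the field point -/

/-- `ρ_r` is `3/(πr⁴)`-Lipschitz in the field point (minimal-image distance). [folklore] -/
theorem abs_rhoC_sub_le {r : ℝ} (hr : 0 < r) (w : Phase N) (x x' : T3) :
    |rhoC r w x - rhoC r w x'| ≤ 3 / (Real.pi * r ^ 4) * Torus.euclidDist x x' :=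
  gridUp_abs_mollDensity_sub_le_centre hr w x x'

/-- `m_r` is `3/(πr⁴)(½ + ke)`-Lipschitz in the field point. [folklore] -/
theorem norm_momC_sub_le {r : ℝ} (hr : 0 < r) (w : Phase N) (x x' : T3) :
    ‖momC r w x - momC r w x'‖ ≤ 3 / (Real.pi * r ^ 4) * (1 / 2 + ke w) * Torus.euclidDist x x' := by
  rw [show momC r w x = ((N + 1 : ℕ) : ℝ)⁻¹ • ∑ i, cone r (w i).1 x • (w i).2 from
      empiricalMomentumField_eq_sum w (fun y => cone r y x),
    show momC r w x' = ((N + 1 : ℕ) : ℝ)⁻¹ • ∑ i, cone r (w i).1 x' • (w i).2 from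
      empiricalMomentumField_eq_sum w (fun y => cone r y x'), ← smul_sub, ← Finset.sum_sub_distrib, norm_smul, Real.norm_eq_abs,
    abs_of_nonneg (by positivity)]
  have hC : 0 ≤ 3 / (Real.pi * r ^ 4) * Torus.euclidDist x x' := by
    refine mul_nonneg (by positivity) ?_
    rw [Torus.euclidDist_eq]; exact norm_nonneg _
  calc ((N + 1 : ℕ) : ℝ)⁻¹ * ‖∑ i, (cone r (w i).1 x • (w i).2 - cone r (w i).1 x' • (w i).2)‖
      ≤ ((N + 1 : ℕ) : ℝ)⁻¹ * ∑ i, 3 / (Real.pi * r ^ 4) * Torus.euclidDist x x' * ‖(w i).2‖ := by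
        gcongr
        refine (norm_sum_le _ _).trans (Finset.sum_le_sum fun i _ => ?_)
        rw [← sub_smul, norm_smul, Real.norm_eq_abs]
        refine mul_le_mul_of_nonneg_right ?_ (norm_nonneg _)
        have h := gridUp_abs_cone_sub_cone_le hr x x' (w i).1
        rw [← densMod_cone_comm r x (w i).1, ← densMod_cone_comm r x' (w i).1] at h
        exact h
    _ = 3 / (Real.pi * r ^ 4) * Torus.euclidDist x x' * (((N + 1 : ℕ) : ℝ)⁻¹ * ∑ i, ‖(w i).2‖) := by
        rw [← Finset.mul_sum]; ring
    _ ≤ 3 / (Real.pi * r ^ 4) * Torus.euclidDist x x' * (1 / 2 + ke w) :=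
        mul_le_mul_of_nonneg_left (meanSpeed_le w) hC
    _ = _ := by ring

/-- Under the floor `ρ_r ≥ c` EVERYWHERE, `u_r = m_r/ρ_r` is Lipschitz in the field point (minimal-image distance) with
the strain constant `K(r, c, ke) = (3/πr⁴)(½+ke)/c + (3/πr³)(½+ke)(3/πr⁴)/c²` of `abs_pD_uC_le_of_floor`. [folklore] -/
theorem norm_uC_sub_le {r c : ℝ} (hr : 0 < r) (hc : 0 < c) (w : Phase N) (hρ : ∀ y, c ≤ rhoC r w y)
    (x x' : T3) : ‖uC r w x - uC r w x'‖ ≤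
      (3 / (Real.pi * r ^ 4) * (1 / 2 + ke w) / c + 3 / (Real.pi * r ^ 3) * (1 / 2 + ke w) * (3 / (Real.pi * r ^ 4)) / c ^ 2) *
        Torus.euclidDist x x' := by
  have hρx : 0 < rhoC r w x := hc.trans_le (hρ x)
  have hρx' : 0 < rhoC r w x' := hc.trans_le (hρ x')
  have hd : 0 ≤ Torus.euclidDist x x' := by rw [Torus.euclidDist_eq]; exact norm_nonneg _
  have hsplit : uC r w x - uC r w x' =
      (rhoC r w x)⁻¹ • (momC r w x - momC r w x') + ((rhoC r w x)⁻¹ - (rhoC r w x')⁻¹) • momC r w x' := by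
    simp only [uC, smul_sub, sub_smul]; abel
  have h1 : ‖(rhoC r w x)⁻¹ • (momC r w x - momC r w x')‖ ≤
      c⁻¹ * (3 / (Real.pi * r ^ 4) * (1 / 2 + ke w) * Torus.euclidDist x x') := by
    rw [norm_smul, Real.norm_eq_abs, abs_of_nonneg (inv_nonneg.2 hρx.le)]
    have hinv : (rhoC r w x)⁻¹ ≤ c⁻¹ := (inv_le_inv₀ hρx hc).2 (hρ x)
    exact mul_le_mul hinv (norm_momC_sub_le hr w x x') (norm_nonneg _) (inv_nonneg.2 hc.le)
  have h2 : ‖((rhoC r w x)⁻¹ - (rhoC r w x')⁻¹) • momC r w x'‖ ≤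
      (3 / (Real.pi * r ^ 4) * Torus.euclidDist x x' / c ^ 2) * (3 / (Real.pi * r ^ 3) * (1 / 2 + ke w)) := by
    rw [norm_smul, Real.norm_eq_abs]
    refine mul_le_mul ?_ (norm_momC_le hr w x') (norm_nonneg _)
      (div_nonneg (mul_nonneg (by positivity) hd) (sq_nonneg c))
    rw [inv_sub_inv hρx.ne' hρx'.ne', abs_div, abs_of_pos (mul_pos hρx hρx'), div_le_div_iff₀ (mul_pos hρx hρx')
      (by positivity), abs_sub_comm]
    calc |rhoC r w x - rhoC r w x'| * c ^ 2 ≤ 3 / (Real.pi * r ^ 4) * Torus.euclidDist x x' * c ^ 2 :=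
          mul_le_mul_of_nonneg_right (abs_rhoC_sub_le hr w x x') (sq_nonneg c)
      _ ≤ 3 / (Real.pi * r ^ 4) * Torus.euclidDist x x' * (rhoC r w x * rhoC r w x') := by
          refine mul_le_mul_of_nonneg_left ?_ (mul_nonneg (by positivity) hd)
          rw [sq]; exact mul_le_mul (hρ x) (hρ x') hc.le hρx.le
  calc ‖uC r w x - uC r w x'‖ ≤ ‖(rhoC r w x)⁻¹ • (momC r w x - momC r w x')‖ +
        ‖((rhoC r w x)⁻¹ - (rhoC r w x')⁻¹) • momC r w x'‖ := by rw [hsplit]; exact norm_add_le _ _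
    _ ≤ _ := add_le_add h1 h2
    _ = _ := by ring

/-! ## The partial derivative of a Lipschitz / continuous field -/

/-- **A Lipschitz field has bounded `pD` everywhere**: if `|f x − f x'| ≤ L·d(x, x')` in the minimal-image distance
then `|∂ₖ f (x)| ≤ L` at EVERY point (where the line derivative does not exist, `pD` is the junk `0`; where it exists
it is a limit of difference quotients bounded by `L`, the coordinate line being `1`-Lipschitz into the torus).
[folklore] -/
theorem abs_pD_le_of_lipschitz :
  ∀ {f : T3 → ℝ} {L : ℝ}, 0 ≤ L → (∀ x x', |f x - f x'| ≤ L * Torus.euclidDist x x') → ∀ (k : Fin 3) (x : T3), |pD k f x| ≤ L := by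
  intro f L hL hf k x
  set E : V3 := EuclideanSpace.single k (1 : ℝ) with hE
  have key : ‖deriv (fun t : ℝ => f (x + tproj (t • E))) 0‖ ≤ L := by
    refine norm_deriv_le_of_lip' hL (Filter.Eventually.of_forall fun t => ?_)
    rw [Real.norm_eq_abs, zero_smul, sub_zero, Real.norm_eq_abs]
    have hx : x + tproj 0 = x := by simp [tproj, Literature.Analysis.FunctionSpaces.Torus.proj_zero]
    rw [hx]
    refine (hf _ _).trans (mul_le_mul_of_nonneg_left ?_ hL)
    have h := Torus.euclidDist_proj_le_norm_sub_holds (Torus.reprSym x + t • E) (Torus.reprSym x)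
    rw [add_sub_cancel_left, norm_smul, Real.norm_eq_abs, hE, PiLp.norm_single, norm_one, mul_one] at h
    have e1 : Literature.Analysis.FunctionSpaces.Torus.proj (Torus.reprSym x + t • E) = x + tproj (t • E) := by
      rw [Literature.Analysis.FunctionSpaces.Torus.proj_add, Torus.proj_reprSym]
    have e2 : Literature.Analysis.FunctionSpaces.Torus.proj (Torus.reprSym x) = x := Torus.proj_reprSym x
    rw [e1, e2] at h
    rw [hE]; exact h
  rw [Real.norm_eq_abs] at key; exact key
/-- **Joint measurability of `pD` for a jointly continuous family**: `(a, x) ↦ ∂ₖ(f a)(x)` is measurable when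
`(a, x) ↦ f a x` is continuous (Mathlib's `measurable_deriv_with_param` for the derivative of the coordinate-line
restriction, at parameter `(a, x)` and time `0`). [folklore] -/
theorem measurable_pD_uncurry {α : Type*} [TopologicalSpace α] [MeasurableSpace α] [OpensMeasurableSpace α]
    {f : α → T3 → ℝ} (hf : Continuous fun p : α × T3 => f p.1 p.2) (k : Fin 3) :
    Measurable fun p : α × T3 => pD k (f p.1) p.2 := by
  set g : (α × T3) → ℝ → ℝ := fun p t => f p.1 (p.2 + tproj (t • EuclideanSpace.single k (1 : ℝ))) with hg
  have hgc : Continuous (Function.uncurry g) := by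
    have h1 : Continuous fun q : (α × T3) × ℝ =>
        (q.1.1, q.1.2 + tproj (q.2 • EuclideanSpace.single k (1 : ℝ))) := by
      refine (continuous_fst.comp continuous_fst).prodMk ((continuous_snd.comp continuous_fst).add ?_)
      exact Literature.Analysis.FunctionSpaces.Torus.continuous_proj.comp (continuous_snd.smul continuous_const)
    exact hf.comp h1
  exact (measurable_deriv_with_param hgc).comp (measurable_id.prodMk measurable_const)

/-- `pD` of a continuous field is measurable in the field point. [folklore] -/
theorem measurable_pD {f : T3 → ℝ} (hf : Continuous f) (k : Fin 3) : Measurable (pD k f) := by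
  exact (measurable_pD_uncurry (α := Unit) (f := fun _ => f) (hf.comp continuous_snd) k).comp
    ((measurable_const (a := ())).prodMk measurable_id)

end Summit.AtomisticToContinuum.HydrodynamicLimit.Theorems.LocalSecondLawLedger

end
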